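import Literature.NumberTheory.Sieve.MaynardK105
import HarnessLib

/-!
# Moments of power-sum products over the simplex (Polymath 8b §7, towards the numerical Theorem 3.13(i))

Trunk: AntSieve / parity.S13.  First file of the computational leaf (Theorem 3.13(i),
`Literature.NumberTheory.Sieve.exists_polymathFunctional_fifty_gt`, `M_{50,1/25} > 4.0043`) of the
decomposition of `Literature.NumberTheory.Sieve.frequently_nth_prime_succ_le_add_polymath` (`H₁ ≤ 246`;
D. H. J. Polymath, *Variants of the Selberg sieve, and bounded intervals containing many primes*,
Res. Math. Sci. 1:12 (2014) = arXiv:1407.4897).  By `PolymathBoundedGapsAssembly.lean` the Wave-0 fact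
now rests on a single certificate: a symmetric test function `F` on `(1+ε)·R_50` with
`(∑ᵢ J_{i,1−ε}(F))/I(F) > 4`.  Following §7.1–7.2 of the paper ("we rely on the previously discussed
approach, in which symmetric polynomials are used for the basis functions … a single change of variables
converts the needed integrals into those of the form in Lemma 7.2"), such certificates are evaluated in
exact arithmetic from the moments of symmetric polynomials over simplices.  This file PROVES the basic
moment formula for the basis of PRODUCTS OF POWER SUMS `(1 − P₁)^a ∏_p p_{v_p}^{c_p}`
(`p_v = ∑_l t_l^v`; products of basis elements are again of this form, which is what makes the exact
evaluation of `I(F) = ∫ F²` and of `J` cheap):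

* `MkEps.psProd v c t = ∏_p (∑_l t_l^{v_p})^{c_p}`, `MkEps.psDeg v c = ∑_p v_p c_p`;
* `MkEps.dSgen v k c = S_k(c)`, DEFINED by the recursion obtained by integrating out one coordinate,
  `S_0(c) = [c = 0]`, `S_{k+1}(c) = ∑_{j ≤ c} (∏_p C(c_p,j_p)) (∑_p v_p j_p)! S_k(c − j)`
  (kernel-computable; for the single part `v = (2)` one has `S_k(c) = c! · MaynardK105.dS k c`);
* `MkEps.psProd_insertNth` (the binomial expansion in the first coordinate) and
  **`MkEps.integral_simplex_psMoment`**: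
  `∫_{R_k} (1 − P₁)^a ∏_p p_{v_p}^{c_p} = a! · S_k(c)/(k + a + ∑_p v_p c_p)!`
  (Polymath 8b Lemma 7.2, the Beta-function identity, summed over the monomials of the power-sum
  product; proof by induction on `k` as `MaynardK105.integral_simplex_moment`, of which it is the
  generalisation from `P₂^c` to arbitrary power-sum products).

Not here (next files): the `(1±ε)`-scaled simplices of §7.2, the inner `t_i`-integral of `J_{i,1−ε}`,
the evaluator and the certificate.

## References

* D. H. J. Polymath, *Variants of the Selberg sieve, and bounded intervals containing many primes*,
  Res. Math. Sci. 1 (2014), Art. 12; arXiv:1407.4897, §7.1 (Lemma 7.2 and the symmetric-polynomial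
  bases, pp. 29–30), §7.2 (p. 31). [Polymath8b2014]
* J. Maynard, *Small gaps between primes*, Ann. of Math. 181 (2015), Lemma 7.1 (the case `P₂`).
  [MaynardAnnals2015]
-/

open MeasureTheory Set Filter Finset intervalIntegral
open scoped BigOperators

noncomputable section

namespace Literature.NumberTheory.Sieve

namespace MkEps

variable {P : ℕ}

/-- The power sums product `∏_p (∑_l t_l^{v_p})^{c_p}` (`v` = the list of exponents, `c` = multiplicities;
Polymath 8b §7.1: bases of symmetric polynomials built from `P_{(v)} = ∑ t_l^v`). [cite: Polymath8b2014, §7.1] -/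
def psProd {k : ℕ} (v : Fin P → ℕ) (c : Fin P → ℕ) (t : Fin k → ℝ) : ℝ :=
  ∏ p, (∑ l, t l ^ v p) ^ c p

/-- The total degree `∑_p v_p c_p` of `psProd v c`. [folklore] -/
def psDeg (v : Fin P → ℕ) (c : Fin P → ℕ) : ℕ := ∑ p, v p * c p

/-- `psProd` is continuous. [folklore] -/
theorem continuous_psProd {k : ℕ} (v : Fin P → ℕ) (c : Fin P → ℕ) :
    Continuous (psProd (k := k) v c) := by
  unfold psProd
  refine continuous_finsetProd _ fun p _ => ?_
  exact (continuous_finsetSum _ fun l _ => (continuous_apply l).pow _).pow _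

/-- **The combinatorial numbers `S_k(c)`** behind the moments of power-sum products, DEFINED by peeling
off one coordinate: `S_0(c) = [c = 0]`,
`S_{k+1}(c) = ∑_{j ≤ c} (∏_p C(c_p, j_p)) (∑_p v_p j_p)! S_k(c − j)`
(`= ∑_{f : parts → [k+1]} ∏_l (load of l)!`; for a single part `v = 2` this is `c! · dS k c` of
`MaynardK105.lean`). [folklore] -/
def dSgen (v : Fin P → ℕ) : ℕ → (Fin P → ℕ) → ℕ
  | 0, c => if c = 0 then 1 else 0
  | k + 1, c => ∑ j ∈ Fintype.piFinset (fun p => Finset.range (c p + 1)),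
      (∏ p, (c p).choose (j p)) * (∑ p, v p * j p).factorial * dSgen v k (c - j)

/-- `S_0(c) = [c = 0]`. [folklore] -/
theorem dSgen_zero (v : Fin P → ℕ) (c : Fin P → ℕ) : dSgen v 0 c = if c = 0 then 1 else 0 := by
  rw [dSgen]

/-- The recursion for `S_{k+1}`. [folklore] -/
theorem dSgen_succ (v : Fin P → ℕ) (k : ℕ) (c : Fin P → ℕ) :
    dSgen v (k + 1) c = ∑ j ∈ Fintype.piFinset (fun p => Finset.range (c p + 1)),
      (∏ p, (c p).choose (j p)) * (∑ p, v p * j p).factorial * dSgen v k (c - j) := by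
  rw [dSgen]

/-- `∑_i (insertNth 0 u s)_i^w = u^w + ∑_j s_j^w`. [folklore] -/
theorem sum_pow_insertNth_eq {n : ℕ} (u : ℝ) (s : Fin n → ℝ) (w : ℕ) :
    ∑ i, (Fin.insertNth 0 u s : Fin (n + 1) → ℝ) i ^ w = u ^ w + ∑ j, s j ^ w := by
  rw [Fin.sum_univ_succ]
  simp [Fin.insertNth_zero']

/-- **The one-coordinate expansion**: inserting `u` as the first coordinate,
`psProd v c (insertNth 0 u s) = ∑_{j ≤ c} (∏_p C(c_p,j_p)) u^{∑ v_p j_p} psProd v (c - j) s`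
(binomial theorem in each power sum, `(u^{v} + p_v(s))^{c}`). [folklore] -/
theorem psProd_insertNth {n : ℕ} (v : Fin P → ℕ) (c : Fin P → ℕ) (u : ℝ) (s : Fin n → ℝ) :
    psProd v c (Fin.insertNth 0 u s) =
      ∑ j ∈ Fintype.piFinset (fun p => Finset.range (c p + 1)),
        ((∏ p, ((c p).choose (j p) : ℝ)) * u ^ (∑ p, v p * j p)) * psProd v (c - j) s := by
  unfold psProd
  simp_rw [sum_pow_insertNth_eq]
  -- binomial theorem in each factor, then the product of sums as a sum over `piFinset`
  have hfac : ∀ p, (u ^ v p + ∑ j, s j ^ v p) ^ c p =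
      ∑ i ∈ Finset.range (c p + 1), ((c p).choose i : ℝ) * u ^ (v p * i) * (∑ j, s j ^ v p) ^ (c p - i) := by
    intro p
    rw [add_pow]
    refine Finset.sum_congr rfl fun i _ => ?_
    rw [pow_mul]; ring
  simp_rw [hfac]
  rw [Finset.prod_univ_sum]
  refine Finset.sum_congr rfl fun j _ => ?_
  rw [Finset.prod_mul_distrib, Finset.prod_mul_distrib, Finset.prod_pow_eq_pow_sum]
  simp only [Pi.sub_apply]

/-- `deg(c − j) + ∑ v_p j_p = deg c` for `j ≤ c`. [folklore] -/
theorem psDeg_sub_add (v : Fin P → ℕ) {c j : Fin P → ℕ} (hj : ∀ p, j p ≤ c p) :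
    psDeg v (c - j) + ∑ p, v p * j p = psDeg v c := by
  unfold psDeg
  rw [← Finset.sum_add_distrib]
  refine Finset.sum_congr rfl fun p _ => ?_
  rw [Pi.sub_apply, ← Nat.mul_add, Nat.sub_add_cancel (hj p)]

/-- Members of the box `∏ [0, c_p]` are `≤ c`. [folklore] -/
theorem le_of_mem_piFinset_range {c j : Fin P → ℕ}
    (hj : j ∈ Fintype.piFinset (fun p => Finset.range (c p + 1))) (p : Fin P) : j p ≤ c p :=
  Nat.lt_succ_iff.1 (Finset.mem_range.1 (Fintype.mem_piFinset.1 hj p))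

/-- At `k = 0` the power-sum product is `[c = 0]`. [folklore] -/
theorem psProd_fin_zero (v : Fin P → ℕ) (c : Fin P → ℕ) (t : Fin 0 → ℝ) :
    psProd v c t = if c = 0 then 1 else 0 := by
  unfold psProd
  simp only [Finset.univ_eq_empty, Finset.sum_empty]
  split_ifs with hc
  · subst hc; simp
  · obtain ⟨p, hp⟩ : ∃ p, c p ≠ 0 := by
      by_contra h
      push Not at h
      exact hc (funext h)
    exact Finset.prod_eq_zero (Finset.mem_univ p) (zero_pow hp)

/-- **Moments of power-sum products over the simplex** (Polymath 8b, Lemma 7.2 "Beta function identity",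
summed over the monomials of `∏_p p_{v_p}^{c_p}`): for every `a` and multiplicities `c`,
`∫_{R_k} (1 − P₁)^a ∏_p p_{v_p}^{c_p} dt = a! · S_k(c) / (k + a + ∑_p v_p c_p)!`
with `S_k(c)` the numbers `dSgen v k c`.  Proof by induction on `k` exactly as
`MaynardK105.integral_simplex_moment`: slice off the first coordinate (`setIntegral_maynardSimplex_succ`),
expand binomially (`psProd_insertNth`), integrate in `u` by the beta identity
(`MaynardK105.integral_sub_pow_mul_pow`) and apply the induction hypothesis.
[cite: Polymath8b2014, Lemma 7.2] -/
theorem integral_simplex_psMoment (v : Fin P → ℕ) (k a : ℕ) (c : Fin P → ℕ) :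
    ∫ t in maynardSimplex k, (1 - ∑ i, t i) ^ a * psProd v c t =
      ((a.factorial * dSgen v k c : ℕ) : ℝ) / (k + a + psDeg v c).factorial := by
  induction k generalizing a c with
  | zero =>
    rw [MaynardTao.maynardSimplex_zero, Measure.restrict_univ, Measure.volume_pi_eq_dirac (0 : Fin 0 → ℝ),
      integral_dirac, psProd_fin_zero, dSgen_zero]
    split_ifs with hc
    · subst hc
      have h : ((a.factorial : ℕ) : ℝ) ≠ 0 := by exact_mod_cast a.factorial_ne_zero
      simp [psDeg, h]
    · simp
  | succ k ih =>
    have hcont : Continuous fun t : Fin (k + 1) → ℝ => (1 - ∑ i, t i) ^ a * psProd v c t :=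
      (by fun_prop : Continuous fun t : Fin (k + 1) → ℝ => (1 - ∑ i, t i) ^ a).mul (continuous_psProd v c)
    rw [MaynardK105.setIntegral_maynardSimplex_succ 0 _
      (hcont.continuousOn.integrableOn_compact (isCompact_maynardSimplex _))]
    -- the box of sub-multiplicities
    set J : Finset (Fin P → ℕ) := Fintype.piFinset (fun p => Finset.range (c p + 1)) with hJdef
    -- the inner `u`-integral
    have hinner : ∀ s : Fin k → ℝ,
        ∫ u in (0:ℝ)..(1 - ∑ i, s i), (1 - ∑ i, Fin.insertNth 0 u s i) ^ a * psProd v c (Fin.insertNth 0 u s) =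
          ∑ j ∈ J, ((∏ p, ((c p).choose (j p) : ℝ)) *
              (((a.factorial * (∑ p, v p * j p).factorial : ℕ) : ℝ) / (a + (∑ p, v p * j p) + 1).factorial)) *
            ((1 - ∑ i, s i) ^ (a + (∑ p, v p * j p) + 1) * psProd v (c - j) s) := by
      intro s
      simp_rw [psProd_insertNth, MaynardTao.sum_insertNth_eq]
      have : ∀ u : ℝ, (1 - (u + ∑ i, s i)) ^ a = ((1 - ∑ i, s i) - u) ^ a := fun u => by ring_nf
      simp_rw [this, Finset.mul_sum]
      rw [intervalIntegral.integral_finsetSum fun j _ => ?_]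
      · refine Finset.sum_congr rfl fun j _ => ?_
        have e : ∀ u : ℝ, ((1 - ∑ i, s i) - u) ^ a * (((∏ p, ((c p).choose (j p) : ℝ)) * u ^ (∑ p, v p * j p)) *
            psProd v (c - j) s) = ((∏ p, ((c p).choose (j p) : ℝ)) * psProd v (c - j) s) *
            (((1 - ∑ i, s i) - u) ^ a * u ^ (∑ p, v p * j p)) := fun u => by ring
        simp_rw [e]
        rw [intervalIntegral.integral_const_mul, MaynardK105.integral_sub_pow_mul_pow]
        ring
      · exact (Continuous.intervalIntegrable (by fun_prop) _ _)
    simp_rw [hinner]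
    have hint : ∀ j ∈ J, Integrable (fun s : Fin k → ℝ =>
        ((∏ p, ((c p).choose (j p) : ℝ)) *
            (((a.factorial * (∑ p, v p * j p).factorial : ℕ) : ℝ) / (a + (∑ p, v p * j p) + 1).factorial)) *
          ((1 - ∑ i, s i) ^ (a + (∑ p, v p * j p) + 1) * psProd v (c - j) s))
        (volume.restrict (maynardSimplex k)) := by
      intro j _
      have hc : Continuous fun s : Fin k → ℝ =>
          ((∏ p, ((c p).choose (j p) : ℝ)) *
            (((a.factorial * (∑ p, v p * j p).factorial : ℕ) : ℝ) / (a + (∑ p, v p * j p) + 1).factorial)) *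
          ((1 - ∑ i, s i) ^ (a + (∑ p, v p * j p) + 1) * psProd v (c - j) s) :=
        continuous_const.mul ((by fun_prop : Continuous fun s : Fin k → ℝ =>
          (1 - ∑ i, s i) ^ (a + (∑ p, v p * j p) + 1)).mul (continuous_psProd v _))
      exact hc.continuousOn.integrableOn_compact (isCompact_maynardSimplex _)
    rw [integral_finsetSum _ hint]
    simp_rw [MeasureTheory.integral_const_mul, ih]
    -- the algebra
    have hterm : ∀ j ∈ J,
        (∏ p, ((c p).choose (j p) : ℝ)) *
            (((a.factorial * (∑ p, v p * j p).factorial : ℕ) : ℝ) / (a + (∑ p, v p * j p) + 1).factorial) *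
          ((((a + (∑ p, v p * j p) + 1).factorial * dSgen v k (c - j) : ℕ) : ℝ) /
            (k + (a + (∑ p, v p * j p) + 1) + psDeg v (c - j)).factorial) =
        ((a.factorial : ℝ) / (k + 1 + a + psDeg v c).factorial) *
          (((∏ p, (c p).choose (j p)) * (∑ p, v p * j p).factorial * dSgen v k (c - j) : ℕ) : ℝ) := by
      intro j hj
      have hjc : ∀ p, j p ≤ c p := le_of_mem_piFinset_range hj
      have h1 : k + (a + (∑ p, v p * j p) + 1) + psDeg v (c - j) = k + 1 + a + psDeg v c := by
        have := psDeg_sub_add v hjc; omega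
      rw [h1]
      have h2 : ((a + (∑ p, v p * j p) + 1).factorial : ℝ) ≠ 0 := by
        exact_mod_cast (a + (∑ p, v p * j p) + 1).factorial_ne_zero
      have h3 : ((k + 1 + a + psDeg v c).factorial : ℝ) ≠ 0 := by
        exact_mod_cast (k + 1 + a + psDeg v c).factorial_ne_zero
      push_cast
      field_simp
    rw [Finset.sum_congr rfl hterm, ← Finset.mul_sum, dSgen_succ]
    push_cast
    rw [hJdef]
    ring

end MkEps

end Literature.NumberTheory.Sieve
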